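import Summits.BirchSwinnertonDyer.BirchSwinnertonDyer.Theorems.ByReductionTypeAtTwoRankOneAtTwoBigImageOddLocalFklLevelOneLaw
import HarnessLib

/-!
# Line `fkl` of crux `RankOneAtTwoBigImageOddLocal` (stmt-BirchSwinnertonDyer-23715, route ByReductionTypeAtTwo):
# K2-F (a) is a THEOREM when `Ш(E)[2^∞] = 0` — every Kurihara number of the first layer is EVEN

Lead prover seat `bsd-line-fkl-p1` (g0), helpers `--supports stmt-BirchSwinnertonDyer-23715` (registered stub
`stub_katoFirstLayerLaw : F1Sign2.FirstLayerLawAtTwo`); sequel to `…FklLevelOneLaw` (p593869).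

`levelSumTwo_inTwoPowZLoc_one`: for the newform `f` of a globally minimal elliptic `W/ℚ` of positive analytic rank, every
odd prime `ℓ ∤ N_W`, every level `k ≥ 1` with `2^k ∣ ℓ − 1` and every surjective `ψ : (ℤ/ℓ)ˣ → ℤ/2^k`, the level-`k`
Kurihara number `δ'_k(ℓ; ψ) = ∑_u 2[u/ℓ]⁺_f ψ(u)` lies in `2ℤ_{(2)}`.  Proof: `2[u/ℓ]⁺ = k_u ∈ ℤ` (positive rank:
`exists_ratPlusSymbol_eq_int_div_two`); `ψ(u) ≡ ψ₂(u) (mod 2)` for the reduction `ψ₂ : (ℤ/ℓ)ˣ ↠ ℤ/2`, which IS the quadratic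
character (`cast_val_toAdd_eq_jacobi`); so `δ'_k ≡ ∑_{(u/ℓ)=−1} k_u (mod 2)`, an even number when `ℓ ≡ 1 (mod 4)` (the
non-residues are `±`-stable, `k_{−u} = k_u`, K2-V pairing lemma `two_dvd_sum_of_involution_invariant`); `ℓ ≡ 3 (mod 4)` forces
`k = 1`, where `δ'_1 = 0` (`levelSumTwo_one_eq_zero`, p592555).
CONSEQUENCE `firstLayerLawAtTwo_a_of_sha_two_trivial`: clause (a) of the hardest stub `F1Sign2.FirstLayerLawAtTwo` — «every
`δ'_k(ℓ; ψ)` lies in `2^{min(k, s+1)} ℤ_{(2)}`» — HOLDS for `s = 0`, i.e. for every slice curve of analytic rank one with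
`Ш(E)[2^∞] = 0`, at EVERY level `k`, EVERY `τ`-prime and EVERY `ψ`, unconditionally (`min(k, 1) = 1`).  What remains of K2-F
on such curves is clause (b) alone: SOME `τ`-prime of level `k ≥ 2` has `δ'_k ≢ 0 (mod 4)` (Kolyvagin non-triviality at `2`);
for `s ≥ 1` clause (a) at levels `2 ≤ k` asks for the higher congruence `δ'_k ≡ 0 (mod 2^{min(k,s+1)})`, open.
Theorems only; no `def`, no named-fact hypothesis, no `sorry`.  BSD is not proved by any of this.
-/

set_option autoImplicit false

noncomputable section

open scoped Classical MatrixGroups ModularForm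

set_option linter.dupNamespace false

namespace Summit.BirchSwinnertonDyer.BirchSwinnertonDyer.Theorems.RankOneAtTwoFkl

open CongruenceSubgroup WeierstrassCurve Literature.NumberTheory.EllipticCurves
  Literature.NumberTheory.EllipticCurves.ModularForms Summit.BirchSwinnertonDyer.Rank1Residual.F1Sign2

/-- `2^k ∣ ℓ − 1` with `k ≥ 1` and `ℓ ≡ 3 (mod 4)` force `k = 1`. [folklore] -/
theorem level_eq_one_of_mod_four_eq_three {ℓ k : ℕ} (hk : 1 ≤ k) (hℓk : (2 ^ k : ℤ) ∣ (ℓ : ℤ) - 1)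
    (h3 : ℓ % 4 = 3) : k = 1 := by
  by_contra hne
  have hk2 : 2 ≤ k := by omega
  have h4 : (4 : ℤ) ∣ (ℓ : ℤ) - 1 := dvd_trans (by simpa using pow_dvd_pow (2 : ℤ) hk2) hℓk
  omega

/-- **Every first-layer Kurihara number is EVEN in positive analytic rank.**  For the newform `f` of a globally minimal
elliptic `W/ℚ` with `r_an(W) ≠ 0`, an odd prime `ℓ ∤ N_W`, a level `k ≥ 1` with `2^k ∣ ℓ − 1`, and a surjective
`ψ : (ℤ/ℓ)ˣ → ℤ/2^k`:  `δ'_k(ℓ; ψ) ∈ 2ℤ_{(2)}`.  See the file header for the proof. [cite: CremonaAlgorithms1997, §2.8]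
[cite: Manin1972, Prop. 1.4 and Thm. 1.6] -/
theorem levelSumTwo_inTwoPowZLoc_one (W : WeierstrassCurve ℚ) [W.IsElliptic] [W.IsGloballyMinimal]
    {M : ℕ} [NeZero M] (f : CuspForm (Gamma0 M) 2) (hf : IsNewformOf W f) (hr : W.analyticRank ≠ 0)
    {ℓ : ℕ} [Fact ℓ.Prime] (hℓ2 : ℓ ≠ 2) (hN : ¬ ℓ ∣ W.conductorNorm ℤ)
    {k : ℕ} (hk : 1 ≤ k) (hℓk : (2 ^ k : ℤ) ∣ (ℓ : ℤ) - 1)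
    (ψ : (ZMod ℓ)ˣ →* Multiplicative (ZMod (2 ^ k))) (hψ : Function.Surjective ψ) :
    InTwoPowZLoc 1 (levelSumTwo f ℓ k ψ) := by
  have hℓ : ℓ.Prime := Fact.out
  haveI : NeZero ℓ := ⟨hℓ.ne_zero⟩
  haveI : NeZero (2 ^ k) := ⟨by positivity⟩
  by_cases h3 : ℓ % 4 = 3
  · -- `ℓ ≡ 3 (mod 4)`: then `k = 1` and `δ'_1 = 0`
    obtain rfl := level_eq_one_of_mod_four_eq_three hk hℓk h3
    rw [levelSumTwo_one_eq_zero W f hf hr ((Nat.Prime.coprime_iff_not_dvd hℓ).mpr hN).symm h3 ψ hψ]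
    exact ⟨0, by simp, by simp⟩
  have h1 : ℓ % 4 = 1 := by
    rcases hℓ.eq_two_or_odd with h | h
    · exact absurd h hℓ2
    · omega
  have hℓM : ¬ ℓ ∣ M := fun h => hN ((hf.dvd_level_iff_dvd_conductorNorm hℓ).mp h)
  have hcop : Nat.Coprime ℓ M := (Nat.Prime.coprime_iff_not_dvd hℓ).mpr hℓM
  -- integer values `kk u = 2[u/ℓ]⁺`
  have hden : ∀ u : (ZMod ℓ)ˣ, Nat.Coprime ((((u : ZMod ℓ).val : ℚ)) / ℓ).den M := fun u => by
    have h := coprime_den_of_coprime (N := M) hcop ((u : ZMod ℓ).val : ℤ)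
    rwa [Int.cast_natCast] at h
  choose kk hkk using fun u : (ZMod ℓ)ˣ =>
    exists_ratPlusSymbol_eq_int_div_two W f hf hr (hden u)
  have hkneg : ∀ u : (ZMod ℓ)ˣ, kk (-u) = kk u := fun u => by
    have h := ratPlusSymbol_neg_unit f u
    rw [hkk (-u), hkk u] at h
    exact_mod_cast (by linarith : (kk (-u) : ℚ) = kk u)
  -- the reduction `ψ₂ = ψ mod 2` is the quadratic character
  set ψ₂ : (ZMod ℓ)ˣ →* Multiplicative (ZMod (2 ^ 1)) :=
    (AddMonoidHom.toMultiplicative (ZMod.castHom (pow_dvd_pow 2 hk) (ZMod (2 ^ 1))).toAddMonoidHom).comp ψ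
    with hψ₂def
  have hψ₂val : ∀ u : (ZMod ℓ)ˣ,
      (Multiplicative.toAdd (ψ₂ u)).val = (Multiplicative.toAdd (ψ u)).val % 2 ^ 1 := by
    intro u
    show ((ZMod.castHom (pow_dvd_pow 2 hk) (ZMod (2 ^ 1))) (Multiplicative.toAdd (ψ u))).val = _
    rw [ZMod.castHom_apply, ZMod.cast_eq_val, ZMod.val_natCast]
  have hψ₂ : Function.Surjective ψ₂ := by
    intro y
    obtain ⟨z, hz⟩ := ZMod.castHom_surjective (pow_dvd_pow 2 hk) (Multiplicative.toAdd y)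
    obtain ⟨u, hu⟩ := hψ (Multiplicative.ofAdd z)
    refine ⟨u, ?_⟩
    show Multiplicative.ofAdd ((ZMod.castHom (pow_dvd_pow 2 hk) (ZMod (2 ^ 1)))
      (Multiplicative.toAdd (ψ u))) = y
    rw [hu, toAdd_ofAdd, hz]
    rfl
  have hbit : ∀ u : (ZMod ℓ)ˣ, (((Multiplicative.toAdd (ψ u)).val % 2 ^ 1 : ℕ) : ℚ) =
      (1 - (jacobiSym (((u : ZMod ℓ).val : ℤ)) ℓ : ℚ)) / 2 := by
    intro u
    rw [← hψ₂val u]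
    exact cast_val_toAdd_eq_jacobi ψ₂ hψ₂ u
  -- the integer weight `g u = (1 − (u/ℓ))/2 · kk u` has an even sum
  let g : (ZMod ℓ)ˣ → ℤ := fun u => if jacobiSym (((u : ZMod ℓ).val : ℤ)) ℓ = 1 then 0 else kk u
  have hg : ∀ u : (ZMod ℓ)ˣ,
      ((1 : ℚ) - (jacobiSym (((u : ZMod ℓ).val : ℤ)) ℓ : ℚ)) / 2 * (kk u : ℚ) = (g u : ℚ) := by
    intro u
    rcases jacobiSym_val_eq_one_or ℓ u with h | h
    · have hgu : g u = 0 := by simp only [g, h, if_true]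
      rw [hgu, h]; push_cast; ring
    · have hgu : g u = kk u := by simp only [g, h]; norm_num
      rw [hgu, h]; push_cast; ring
  have hgeven : (2 : ℤ) ∣ ∑ u : (ZMod ℓ)ˣ, g u := by
    refine two_dvd_sum_of_involution_invariant Finset.univ (fun u => -u) (fun u _ => Finset.mem_univ _)
      (fun u _ => neg_neg u) (fun u _ => neg_ne_self_unit hℓ2 u) g fun u _ => ?_
    simp only [g, jacobiSym_neg_unit_val_of_mod_four_eq_one h1, hkneg]
  obtain ⟨m, hm⟩ := hgeven
  -- `δ'_k = ∑ kk·v = ∑ kk·(2 (v/2) + v % 2) = 2 A + ∑ g`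
  have hδ : levelSumTwo f ℓ k ψ =
      2 * (∑ u : (ZMod ℓ)ˣ, (kk u : ℚ) * (((Multiplicative.toAdd (ψ u)).val / 2 ^ 1 : ℕ) : ℚ)) +
        ∑ u : (ZMod ℓ)ˣ, (g u : ℚ) := by
    unfold levelSumTwo
    rw [Finset.mul_sum, ← Finset.sum_add_distrib]
    refine Finset.sum_congr rfl fun u _ => ?_
    have hv : ((Multiplicative.toAdd (ψ u)).val : ℚ) =
        2 * (((Multiplicative.toAdd (ψ u)).val / 2 ^ 1 : ℕ) : ℚ) +
          (((Multiplicative.toAdd (ψ u)).val % 2 ^ 1 : ℕ) : ℚ) := by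
      have h := Nat.div_add_mod ((Multiplicative.toAdd (ψ u)).val) (2 ^ 1)
      have h' : (((2 ^ 1 * ((Multiplicative.toAdd (ψ u)).val / 2 ^ 1) +
          (Multiplicative.toAdd (ψ u)).val % 2 ^ 1 : ℕ)) : ℚ) = ((Multiplicative.toAdd (ψ u)).val : ℚ) := by
        exact_mod_cast h
      rw [← h']; push_cast; ring
    rw [hkk u, hv, hbit u, ← hg u]
    ring
  have hA : ((∑ u : (ZMod ℓ)ˣ, kk u * (((Multiplicative.toAdd (ψ u)).val / 2 ^ 1 : ℕ) : ℤ) : ℤ) : ℚ) =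
      ∑ u : (ZMod ℓ)ˣ, (kk u : ℚ) * (((Multiplicative.toAdd (ψ u)).val / 2 ^ 1 : ℕ) : ℚ) := by
    push_cast; rfl
  have hG : ((∑ u : (ZMod ℓ)ˣ, g u : ℤ) : ℚ) = ∑ u : (ZMod ℓ)ˣ, (g u : ℚ) := by push_cast; rfl
  refine ⟨(((∑ u : (ZMod ℓ)ˣ, kk u * (((Multiplicative.toAdd (ψ u)).val / 2 ^ 1 : ℕ) : ℤ)) + m : ℤ) : ℚ),
    ?_, by rw [Rat.den_intCast]; exact odd_one⟩
  rw [hδ, ← hA, ← hG, hm]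
  push_cast
  ring

/-- **K2-F (a) for `Ш(E)[2^∞] = 0` — a THEOREM on the slice.**  In the setting of the hardest stub
`F1Sign2.FirstLayerLawAtTwo` with analytic rank one: if the parameter is `s = 0` (i.e. `#Ш(E)[2^∞] = 1`), clause (a) —
`δ'_k(ℓ; ψ) ∈ 2^{min(k, s+1)} ℤ_{(2)} = 2ℤ_{(2)}` — holds at EVERY level `k ≥ 1`, EVERY `τ`-prime `ℓ` with `2^k ∣ ℓ − 1` and
EVERY surjective `ψ`, unconditionally (`levelSumTwo_inTwoPowZLoc_one`; the hypothesis `2^k ∣ a_ℓ − 2` and the slice binders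
are idle).  [conjecture] half, kernel theorem. -/
theorem firstLayerLawAtTwo_a_of_sha_two_trivial (W : WeierstrassCurve ℚ) [W.IsElliptic] [W.IsGloballyMinimal]
    {M : ℕ} [NeZero M] (f : CuspForm (Gamma0 M) 2) (hf : IsNewformOf W f) (han : W.analyticRank = 1)
    (ℓ k : ℕ) [Fact ℓ.Prime] (hlev : IsLevelAtTwo W ℓ) (hk : 1 ≤ k) (hℓk : (2 ^ k : ℤ) ∣ (ℓ : ℤ) - 1)
    (ψ : (ZMod ℓ)ˣ →* Multiplicative (ZMod (2 ^ k))) (hψ : Function.Surjective ψ) :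
    InTwoPowZLoc (min k (0 + 1)) (levelSumTwo f ℓ k ψ) := by
  have h2N : ¬ ℓ ∣ 2 * W.conductorNorm ℤ := (hlev.2 ℓ (dvd_refl ℓ)).1
  have hℓ2 : ℓ ≠ 2 := by
    rintro rfl
    exact h2N (dvd_mul_right 2 _)
  have hN : ¬ ℓ ∣ W.conductorNorm ℤ := fun h => h2N (dvd_mul_of_dvd_right h 2)
  have hmin : min k (0 + 1) = 1 := by omega
  rw [hmin]
  exact levelSumTwo_inTwoPowZLoc_one W f hf (by rw [han]; exact one_ne_zero) hℓ2 hN hk hℓk ψ hψ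

/-- **At every level the WEAK bound of K2-F (a) holds** (any `s`): `δ'_k(ℓ; ψ) ∈ 2^{min(k, s+1, 1)} ℤ_{(2)}`, i.e. the
`j = 1` shadow `InTwoPowZLoc 1` of clause (a), for every slice curve of analytic rank one, every level, every `τ`-prime and
every `ψ` — what is open is only the HIGHER congruence `2^{min(k,s+1)}` for `s ≥ 1`, `k ≥ 2`, and clause (b).
[conjecture] shadow, kernel theorem. -/
theorem firstLayerLawAtTwo_a_weak (W : WeierstrassCurve ℚ) [W.IsElliptic] [W.IsGloballyMinimal]
    {M : ℕ} [NeZero M] (f : CuspForm (Gamma0 M) 2) (hf : IsNewformOf W f) (han : W.analyticRank = 1)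
    (s ℓ k : ℕ) [Fact ℓ.Prime] (hlev : IsLevelAtTwo W ℓ) (hk : 1 ≤ k) (hℓk : (2 ^ k : ℤ) ∣ (ℓ : ℤ) - 1)
    (ψ : (ZMod ℓ)ˣ →* Multiplicative (ZMod (2 ^ k))) (hψ : Function.Surjective ψ) :
    InTwoPowZLoc (min (min k (s + 1)) 1) (levelSumTwo f ℓ k ψ) := by
  have hmin : min (min k (s + 1)) 1 = min k (0 + 1) := by omega
  rw [hmin]
  exact firstLayerLawAtTwo_a_of_sha_two_trivial W f hf han ℓ k hlev hk hℓk ψ hψ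

end Summit.BirchSwinnertonDyer.BirchSwinnertonDyer.Theorems.RankOneAtTwoFkl

end
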